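import Literature.NumberTheory.EllipticCurves.TwoDescentSelmerBookkeeping
import Literature.NumberTheory.EllipticCurves.TwoDescentLocalI0
import Literature.NumberTheory.EllipticCurves.TwoDescentLocalTwo
import Literature.NumberTheory.EllipticCurves.BSDSelmerSmithRootNumberDensityProofs
import Literature.NumberTheory.EllipticCurves.ModularityVersionApProofs
import Mathlib.NumberTheory.LegendreSymbol.QuadraticReciprocity
import HarnessLib

/-!
# D0≤2, the first genus step: Selmer classes of `E₀^{(−p₀)}` versus Selmer classes of `E₀`

Crux R″ `RankOneTwoTorsionResidualAtTwo` (stmt-27478), LINE 49 «full_vertex», stub D0≤2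
`FullTorsionGenusSelmerLawUpToTwoAtTwo` (pure `2`-descent; LEAD memo `D0le2_memo.md`, evidence #48): for a base
`E₀` with full rational `2`-torsion, rank `0`, `Ш(E₀)[2] = 0` and a Heegner prime `p₀ ≡ 7 (mod 8)` with every
`ℓ ∣ 2N₀` split in `ℚ(√−p₀)`, the `2`-Selmer group of the twist `C₁ = E₀^{(−p₀)}` has order `8`. THIS FILE proves the
two class-transfer lemmas of the count (the count itself is the sequel `…D0NegPrimeTwistCount.lean`), for
`E = E₀ : y² = …` with roots `e₁ < e₂, e₃`, a finite set `S ∋ 2` of primes containing the support of the conductor and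
of the root differences, and a prime `p ∉ S`, `p ≡ 7 (mod 8)`, with `(−p/ℓ) = 1` for every odd `ℓ ∈ S`:

* `qrBit_prime_eq_zero_of_mem` — **(R2)** every `ℓ ∈ S` (and `2`) is a residue mod `p`, `−1` is not
  (quadratic reciprocity; `p ≡ 7 (mod 8)`);
* `isSquare_neg_prime_adicCompletion_of_mem` — `−p` is a square in `ℚ_ℓ` for every `ℓ ∈ S` (including `ℓ = 2`);
* **`pos_and_mem_selmerGroup_of_twist`** — a class of `Sel⁽²⁾(E^{(−p)}/ℚ)` whose components `([a],[b])` have EVEN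
  `p`-valuation has `a, b > 0` and the SAME-component class of `E` lies in `Sel⁽²⁾(E/ℚ)`
  (at `ℓ ∈ S`: the twist by the local square `−p` does not change the local condition; at `ℓ ∉ S`: both components
  are `ℓ`-units and `E` has good reduction; at `∞`: both components are positive because they are residues at `p`
  and every prime of their square-free kernel is a residue while `−1` is not);
* **`mem_selmerGroup_twist_of_pos`** — conversely a class of `Sel⁽²⁾(E/ℚ)` with `b > 0` (and then `a > 0`) gives
  a class of `Sel⁽²⁾(E^{(−p)}/ℚ)` with the same components, of even `p`-valuations
  (at `p`: both components are `p`-adic squares).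

No statement of LINE 49 is restated; everything is proved; BSD is not advanced by this file alone.

## References

* [SilvermanAEC2009] J. H. Silverman, *The Arithmetic of Elliptic Curves*, 2nd ed., GTM 106, Springer 2009,
  Prop. X.1.4, Prop. X.4.9, Thm. X.4.2.
* [Kramer1981] K. Kramer, *Arithmetic of elliptic curves upon quadratic extension*, Trans. AMS 264 (1981),
  Props. 1–3, Thm. 1.
* [ShuZhai2021] J. Shu, S. Zhai, arXiv:2102.11808, Thm. 1.4 (ii) (the splitting conditions at `2N`).
-/

noncomputable section

open scoped Classical

namespace Summit.BirchSwinnertonDyer.BirchSwinnertonDyer.Theorems.GenusKolyvaginAtTwo.TorsionCellD0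

open WeierstrassCurve WeierstrassCurve.Affine WeierstrassCurve.Affine.Point
open Literature.NumberTheory.GaloisRepresentations Literature.NumberTheory.EllipticCurves Field
open Literature.NumberTheory.EllipticCurves.TwoDescentLocal
open Literature.NumberTheory.EllipticCurves.KramerTwoDescent
open IsDedekindDomain NumberField Rat.HeightOneSpectrum

/-! ## (R2): the symbols at a prime `p ≡ 7 (mod 8)` under the splitting condition -/

section Symbols

variable {p : ℕ} [hp : Fact p.Prime]

/-- `p ≡ 7 (mod 8)`: `p` is odd, `p ≡ 3 (mod 4)`. [folklore] -/
private theorem p_ne_two (hp8 : p % 8 = 7) : p ≠ 2 := by rintro rfl; norm_num at hp8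

/-- **`qr_p(−1) = 1`** for `p ≡ 7 (mod 8)` (`(−1/p) = −1`). [folklore] -/
theorem qrBit_neg_one_eq_one (hp8 : p % 8 = 7) : qrBit p (-1 : ℚ) = 1 := by
  have hj : jacobiSym (-1) p = -1 := by
    rw [← jacobiSym.legendreSym.to_jacobiSym, legendreSym.at_neg_one (p_ne_two hp8), ZMod.χ₄_nat_eq_if_mod_four,
      if_neg (by omega), if_neg (by omega)]
  have h := qrBit_intCast_of_jacobiSym_eq_neg_one (p := p) hj
  exact_mod_cast h

/-- **`qr_p(2) = 0`** for `p ≡ 7 (mod 8)` (`(2/p) = 1`). [folklore] -/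
theorem qrBit_two_eq_zero (hp8 : p % 8 = 7) : qrBit p (2 : ℚ) = 0 := by
  have hj : jacobiSym 2 p = 1 := by
    rw [← jacobiSym.legendreSym.to_jacobiSym, legendreSym.at_two (p_ne_two hp8), ZMod.χ₈_nat_eq_if_mod_eight,
      if_neg (by omega), if_pos (Or.inr hp8)]
  have h := qrBit_intCast_of_jacobiSym_eq_one (p := p) hj
  exact_mod_cast h

/-- **(R2): `qr_p(ℓ) = 0` for an odd prime `ℓ ≠ p` with `(−p/ℓ) = 1`** and `p ≡ 3 (mod 4)`: by quadratic
reciprocity `(ℓ/p) = (−p/ℓ)`. [folklore] -/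
theorem qrBit_prime_eq_zero_of_legendreSym (hp8 : p % 8 = 7) {ℓ : ℕ} (hℓ : ℓ.Prime) (hℓ2 : ℓ ≠ 2) (hℓp : ℓ ≠ p)
    (hsplit : haveI : Fact ℓ.Prime := ⟨hℓ⟩; legendreSym ℓ (-(p : ℤ)) = 1) : qrBit p (ℓ : ℚ) = 0 := by
  haveI : Fact ℓ.Prime := ⟨hℓ⟩
  have hp2 := p_ne_two hp8
  have hp4 : p % 4 = 3 := by omega
  -- `(ℓ/p) = (−p/ℓ) = 1`
  have key : legendreSym p ℓ = 1 := by
    have hmul : legendreSym ℓ (-(p : ℤ)) = legendreSym ℓ (-1) * legendreSym ℓ p := by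
      rw [neg_eq_neg_one_mul, legendreSym.mul]
    rw [hmul, legendreSym.at_neg_one hℓ2, ZMod.χ₄_nat_eq_if_mod_four, if_neg (by
      have := hℓ.eq_one_or_self_of_dvd 2; omega)] at hsplit
    rcases Nat.odd_mod_four_iff.mp (Nat.odd_iff.mp (hℓ.odd_of_ne_two hℓ2)) with h1 | h3
    · rw [if_pos h1, one_mul] at hsplit
      rw [legendreSym.quadratic_reciprocity_one_mod_four h1 hp2]; exact hsplit
    · rw [if_neg (by omega), neg_one_mul, legendreSym.quadratic_reciprocity_three_mod_four hp4 h3, neg_neg] at hsplit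
      exact hsplit
  have hj : jacobiSym (ℓ : ℤ) p = 1 := by rw [← jacobiSym.legendreSym.to_jacobiSym]; exact key
  have h := qrBit_intCast_of_jacobiSym_eq_one (p := p) hj
  exact_mod_cast h

/-- `−p` is a square in `ℚ_v` for a finite place `v` over an odd prime `ℓ ≠ p` with `(−p/ℓ) = 1`. [folklore] -/
theorem isSquare_neg_prime_adicCompletion_odd (v : HeightOneSpectrum (𝓞 ℚ)) {ℓ : ℕ} [hℓ : Fact ℓ.Prime]
    (hv : (primesEquiv v : ℕ) = ℓ) (hℓ2 : ℓ ≠ 2) (hℓp : ℓ ≠ p) (hsplit : legendreSym ℓ (-(p : ℤ)) = 1) :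
    IsSquare (algebraMap ℚ (v.adicCompletion ℚ) (-(p : ℚ))) := by
  have h0 : (-(p : ℚ)) ≠ 0 := neg_ne_zero.mpr (by exact_mod_cast hp.out.ne_zero)
  have hvp : padicValRat ℓ (p : ℚ) = 0 := by
    rw [show (p : ℚ) = ((p : ℕ) : ℚ) from rfl, padicValRat.of_nat]
    exact_mod_cast padicValNat_primes hℓp
  refine isSquare_algebraMap_adicCompletion_of_bits v hv hℓ2 h0 ?_ ?_
  · rw [parityBit, padicValRat.neg, hvp, Int.cast_zero]
  · have hj : jacobiSym (-(p : ℤ)) ℓ = 1 := by rw [← jacobiSym.legendreSym.to_jacobiSym]; exact hsplit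
    have h := qrBit_intCast_of_jacobiSym_eq_one (p := ℓ) hj
    exact_mod_cast h

/-- `−p` is a square in `ℚ_v` for the place `v` over `2` when `p ≡ 7 (mod 8)`. [folklore] -/
theorem isSquare_neg_prime_adicCompletion_two (hp8 : p % 8 = 7) (v : HeightOneSpectrum (𝓞 ℚ))
    (hv : (primesEquiv v : ℕ) = 2) : IsSquare (algebraMap ℚ (v.adicCompletion ℚ) (-(p : ℚ))) := by
  have hp2 := p_ne_two hp8
  have h0 : (-(p : ℚ)) ≠ 0 := neg_ne_zero.mpr (by exact_mod_cast hp.out.ne_zero)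
  haveI : Fact (Nat.Prime 2) := ⟨Nat.prime_two⟩
  have hodd : ¬ (2 : ℤ) ∣ -(p : ℤ) := by
    rw [Int.dvd_neg]; intro h
    have := (Nat.prime_dvd_prime_iff_eq Nat.prime_two hp.out).mp (by exact_mod_cast h)
    exact hp2 this.symm
  refine isSquare_algebraMap_adicCompletion_two_of_res8 v hv h0 ?_ ?_
  · rw [padicValRat.neg, show (p : ℚ) = ((p : ℤ) : ℚ) by push_cast; rfl, padicValRat.of_int,
      padicValInt.eq_zero_of_not_dvd (by rw [← Int.dvd_neg]; exact hodd)]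
    exact ⟨0, rfl⟩
  · rw [show (-(p : ℚ)) = ((-(p : ℤ) : ℤ) : ℚ) by push_cast; rfl, res8_intCast hodd]
    have h8 : (8 : ℤ) ∣ -(p : ℤ) - 1 := by omega
    have := (ZMod.intCast_eq_intCast_iff_dvd_sub 1 (-(p : ℤ)) (2 ^ 3)).mpr (by norm_num; exact h8)
    rw [← this]; simp

end Symbols

/-! ## The setting and the two transfers -/

section Transfer

variable (E : WeierstrassCurve ℚ) [E.IsElliptic] {e₁ e₂ e₃ : ℚ} (h : E.toAffine.SplitTwoTorsion e₁ e₂ e₃)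
variable (S : Finset ℕ) {p : ℕ} [hp : Fact p.Prime]

include h in
/-- The root differences of the twist by `−p` are units off `S ∪ {p}`. [folklore] -/
private theorem good_twist
    (hgood : ∀ ℓ : ℕ, (hℓ : ℓ.Prime) → ℓ ∉ S → haveI : Fact ℓ.Prime := ⟨hℓ⟩;
      padicValRat ℓ (e₁ - e₂) = 0 ∧ padicValRat ℓ (e₁ - e₃) = 0 ∧ padicValRat ℓ (e₂ - e₃) = 0)
    (ℓ : ℕ) (hℓ : ℓ.Prime) (hℓS : ℓ ∉ insert p S) :
    haveI : Fact ℓ.Prime := ⟨hℓ⟩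
    padicValRat ℓ (-(p : ℚ) * e₁ - -(p : ℚ) * e₂) = 0 ∧ padicValRat ℓ (-(p : ℚ) * e₁ - -(p : ℚ) * e₃) = 0 ∧
      padicValRat ℓ (-(p : ℚ) * e₂ - -(p : ℚ) * e₃) = 0 := by
  haveI : Fact ℓ.Prime := ⟨hℓ⟩
  rw [Finset.mem_insert, not_or] at hℓS
  obtain ⟨h12, h13, h23⟩ := hgood ℓ hℓ hℓS.2
  haveI : Fact p.Prime := hp
  have hpℓ : padicValRat ℓ (-(p : ℚ)) = 0 := by
    rw [padicValRat.neg, show (p : ℚ) = ((p : ℕ) : ℚ) from rfl, padicValRat.of_nat]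
    exact_mod_cast padicValNat_primes hℓS.1
  have hp0 : (-(p : ℚ)) ≠ 0 := neg_ne_zero.mpr (by exact_mod_cast hp.out.ne_zero)
  refine ⟨?_, ?_, ?_⟩
  · rw [← mul_sub, padicValRat.mul hp0 (sub_ne_zero.mpr h.ne₁₂), hpℓ, h12, add_zero]
  · rw [← mul_sub, padicValRat.mul hp0 (sub_ne_zero.mpr h.ne₁₃), hpℓ, h13, add_zero]
  · rw [← mul_sub, padicValRat.mul hp0 (sub_ne_zero.mpr h.ne₂₃), hpℓ, h23, add_zero]

/-- An `S`-supported square-free kernel `ε ∏_{ℓ∈T} ℓ`, `T ⊆ S`, as an integer. [folklore] -/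
private theorem kernel_intCast {T : Finset ℕ} {ε : ℚ} (hε : ε = 1 ∨ ε = -1) :
    ∃ m : ℤ, (m : ℚ) = ε * ∏ ℓ ∈ T, (ℓ : ℚ) ∧ ∀ q : ℕ, q.Prime → q ∉ T → (∀ ℓ ∈ T, ℓ.Prime) → ¬ (q : ℤ) ∣ m := by
  have hεZ : ∃ e : ℤ, (e : ℚ) = ε ∧ (e = 1 ∨ e = -1) := by
    rcases hε with h1 | h1
    · exact ⟨1, by rw [h1]; norm_num, Or.inl rfl⟩
    · exact ⟨-1, by rw [h1]; norm_num, Or.inr rfl⟩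
  obtain ⟨e, he, he1⟩ := hεZ
  refine ⟨e * ∏ ℓ ∈ T, (ℓ : ℤ), by rw [← he]; push_cast; rfl, ?_⟩
  intro q hq hqT hTp hdvd
  have hqprime : Prime (q : ℤ) := Nat.prime_iff_prime_int.mp hq
  rcases hqprime.dvd_or_dvd hdvd with h1 | h2
  · rcases he1 with rfl | rfl
    · exact hq.ne_one (by exact_mod_cast Int.eq_one_of_dvd_one (by positivity) h1)
    · exact hq.ne_one (by exact_mod_cast Int.eq_one_of_dvd_one (by positivity) (Int.dvd_neg.mp h1))
  · obtain ⟨ℓ, hℓT, hℓ⟩ := (Prime.dvd_finsetProd_iff hqprime _).mp h2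
    have := (Nat.prime_dvd_prime_iff_eq hq (hTp ℓ hℓT)).mp (Int.natCast_dvd_natCast.mp hℓ)
    exact hqT (this ▸ hℓT)

/-- **A `p`-unramified Selmer class of `E^{(−p)}` is POSITIVE and gives a Selmer class of `E`.** In the setting
of the file (`S ∋ 2` primes supporting the root differences and the conductor of `E`; `p ∉ S`, `p ≡ 7 (mod 8)`,
`(−p/ℓ) = 1` for odd `ℓ ∈ S`): if `c' ∈ Sel⁽²⁾(E^{(−p)}/ℚ)` has components `([a],[b])` (roots `−p eᵢ`) with
`v_p(a)`, `v_p(b)` even, then `0 < a`, `0 < b` and `c_E(a, b) ∈ Sel⁽²⁾(E/ℚ)`.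
[cite: SilvermanAEC2009, Prop. X.1.4, Prop. X.4.9] [cite: Kramer1981, Thm. 1] -/
theorem pos_and_mem_selmerGroup_of_twist (hS : ∀ q ∈ S, q.Prime) (h2S : 2 ∈ S)
    (hgood : ∀ ℓ : ℕ, (hℓ : ℓ.Prime) → ℓ ∉ S → haveI : Fact ℓ.Prime := ⟨hℓ⟩;
      padicValRat ℓ (e₁ - e₂) = 0 ∧ padicValRat ℓ (e₁ - e₃) = 0 ∧ padicValRat ℓ (e₂ - e₃) = 0)
    (hN : ∀ ℓ : ℕ, ℓ.Prime → ℓ ∉ S → ¬ ℓ ∣ E.conductorNorm ℤ)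
    (hpS : p ∉ S) (hp8 : p % 8 = 7)
    (hsplit : ∀ ℓ ∈ S, (hℓ : ℓ.Prime) → ℓ ≠ 2 → haveI : Fact ℓ.Prime := ⟨hℓ⟩; legendreSym ℓ (-(p : ℤ)) = 1)
    [(E.quadraticTwist (-(p : ℚ))).IsElliptic]
    {c' : galH1Torsion (E.quadraticTwist (-(p : ℚ))) 2} (hc' : c' ∈ selmerGroup (E.quadraticTwist (-(p : ℚ))) 2)
    (a b : ℚˣ)
    (ha : kummerEquiv ℚ 2 ((E.quadraticTwist (-(p : ℚ))).twoTorsionCharH1 (h.quadraticTwist (-(p : ℚ))) c') =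
      Additive.ofMul (QuotientGroup.mk a))
    (hb : kummerEquiv ℚ 2 ((E.quadraticTwist (-(p : ℚ))).twoTorsionCharH1 (h.quadraticTwist (-(p : ℚ))).swap₁₂ c') =
      Additive.ofMul (QuotientGroup.mk b))
    (hpa : parityBit p (a : ℚ) = 0) (hpb : parityBit p (b : ℚ) = 0) :
    0 < (a : ℚ) ∧ 0 < (b : ℚ) ∧ E.twoDescentClass h a b ∈ E.selmerGroup 2 := by
  have h' := h.quadraticTwist (-(p : ℚ))
  have hp2 : p ≠ 2 := p_ne_two hp8
  have hSp : ∀ q ∈ insert p S, q.Prime := fun q hq => by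
    rcases Finset.mem_insert.mp hq with rfl | hq
    · exact hp.out
    · exact hS q hq
  have hvp : padicValRat p (-(p : ℚ)) = 1 := by
    rw [padicValRat.neg, padicValRat.self hp.out.one_lt]
  obtain ⟨h12, h13, h23⟩ := hgood p hp.out hpS
  -- residues at `p` vanish (the `I₀*` relations with even parities)
  obtain ⟨hqa, hqb⟩ := E.qrBit_eq_zero_quadraticTwist_of_parityBit_eq_zero h (q := p) hvp h12 h13 h23 hc' a b ha hb hpa hpb
  -- square-free kernels of `a` and `b` relative to `S ∪ {p}`
  have hgood' := good_twist E h S (p := p) hgood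
  obtain ⟨Ta, hTaS, εa, hεa, hεapos, hga, hmka, hpara, hqra⟩ := (E.quadraticTwist (-(p : ℚ))).exists_kernel_of_mem_selmerGroup h' (insert p S) hSp
    (fun ℓ hℓ hℓS => ⟨(hgood' ℓ hℓ hℓS).1, (hgood' ℓ hℓ hℓS).2.1⟩) hc' a ha
  obtain ⟨Tb, hTbS, εb, hεb, hεbpos, hgb, hmkb, hparb, hqrb⟩ := (E.quadraticTwist (-(p : ℚ))).exists_kernel_of_mem_selmerGroup h'.swap₁₂ (insert p S) hSp
    (fun ℓ hℓ hℓS => ⟨by rw [← neg_sub, padicValRat.neg]; exact (hgood' ℓ hℓ hℓS).1, (hgood' ℓ hℓ hℓS).2.2⟩) hc' b hb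
  -- `p ∉ T`, so `T ⊆ S`
  have hpTa : p ∉ Ta := fun hpT => by have := hpara p; rw [if_pos hpT] at this; rw [this] at hpa; exact one_ne_zero hpa
  have hpTb : p ∉ Tb := fun hpT => by have := hparb p; rw [if_pos hpT] at this; rw [this] at hpb; exact one_ne_zero hpb
  have hTaS' : Ta ⊆ S := fun ℓ hℓ => by
    rcases Finset.mem_insert.mp (hTaS hℓ) with rfl | h
    · exact absurd hℓ hpTa
    · exact h
  have hTbS' : Tb ⊆ S := fun ℓ hℓ => by
    rcases Finset.mem_insert.mp (hTbS hℓ) with rfl | h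
    · exact absurd hℓ hpTb
    · exact h
  -- (R2): every prime of `S` is a residue at `p`
  have hR2 : ∀ ℓ ∈ S, qrBit p (ℓ : ℚ) = 0 := by
    intro ℓ hℓ
    by_cases hℓ2 : ℓ = 2
    · rw [hℓ2]; exact_mod_cast qrBit_two_eq_zero hp8
    · exact qrBit_prime_eq_zero_of_legendreSym hp8 (hS ℓ hℓ) hℓ2 (fun h => hpS (h ▸ hℓ)) (hsplit ℓ hℓ (hS ℓ hℓ) hℓ2)
  -- hence the signs are `+`
  have hεa1 : εa = 1 := by
    have hq := hqra p hpTa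
    rw [hqa, Finset.sum_eq_zero (fun ℓ hℓ => hR2 ℓ (hTaS' hℓ)), add_zero] at hq
    rcases hεa with h1 | h1
    · exact h1
    · rw [h1, qrBit_neg_one_eq_one hp8] at hq; exact absurd hq.symm one_ne_zero
  have hεb1 : εb = 1 := by
    have hq := hqrb p hpTb
    rw [hqb, Finset.sum_eq_zero (fun ℓ hℓ => hR2 ℓ (hTbS' hℓ)), add_zero] at hq
    rcases hεb with h1 | h1
    · exact h1
    · rw [h1, qrBit_neg_one_eq_one hp8] at hq; exact absurd hq.symm one_ne_zero
  have hapos : 0 < (a : ℚ) := hεapos.mp hεa1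
  have hbpos : 0 < (b : ℚ) := hεbpos.mp hεb1
  refine ⟨hapos, hbpos, ?_⟩
  -- integer kernels
  obtain ⟨ma, hma, hmadiv⟩ := kernel_intCast (T := Ta) hεa
  obtain ⟨mb, hmb, hmbdiv⟩ := kernel_intCast (T := Tb) hεb
  have hma0 : (ma : ℚ) ≠ 0 := by rw [hma]; exact hga
  have hmb0 : (mb : ℚ) ≠ 0 := by rw [hmb]; exact hgb
  have hmka' : (QuotientGroup.mk a : SqUnits ℚ) = QuotientGroup.mk (Units.mk0 (ma : ℚ) hma0) := by
    rw [hmka]; congr 1; exact Units.ext (by rw [Units.val_mk0, Units.val_mk0, hma])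
  have hmkb' : (QuotientGroup.mk b : SqUnits ℚ) = QuotientGroup.mk (Units.mk0 (mb : ℚ) hmb0) := by
    rw [hmkb]; congr 1; exact Units.ext (by rw [Units.val_mk0, Units.val_mk0, hmb])
  -- the class `c'` IS `c_{W'}(a, b)`
  have hc'eq : c' = (E.quadraticTwist (-(p : ℚ))).twoDescentClass h' a b :=
    (E.quadraticTwist (-(p : ℚ))).eq_twoDescentClass_of_kummerEquiv_eq h' a b ha hb
  -- place by place
  rw [mem_selmerGroup_iff]
  refine ⟨fun v => ?_, fun w => ?_⟩
  · by_cases hvS : (primesEquiv v : ℕ) ∈ S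
    · -- `ℓ ∈ S`: `−p` is a local square; transfer from `W'`
      have hsq : IsSquare (algebraMap ℚ (v.adicCompletion ℚ) (-(p : ℚ))) := by
        by_cases hv2 : (primesEquiv v : ℕ) = 2
        · exact isSquare_neg_prime_adicCompletion_two hp8 v hv2
        · haveI : Fact (primesEquiv v : ℕ).Prime := ⟨(primesEquiv v).2⟩
          exact isSquare_neg_prime_adicCompletion_odd v rfl hv2 (fun h => hpS (h ▸ hvS))
            (hsplit _ hvS (primesEquiv v).2 hv2)
      have hloc : (E.quadraticTwist (-(p : ℚ))).twoDescentClass h' a b ∈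
          selmerLocalKer (E.quadraticTwist (-(p : ℚ))) (v.adicCompletion ℚ) 2 := by
        rw [← hc'eq]; exact ((mem_selmerGroup_iff _ _ _).mp hc').1 v
      exact (E.twoDescentClass_quadraticTwist_mem_selmerLocalKer_iff (v.adicCompletion ℚ)
        (charZero_of_injective_algebraMap (algebraMap ℚ _).injective) h hsq a b).mp hloc
    · -- `ℓ ∉ S`: good reduction, unit components
      have hℓ := (primesEquiv v).2
      have hℓ2 : (primesEquiv v : ℕ) ≠ 2 := fun h2 => hvS (h2 ▸ h2S)
      have hgoodv : E.HasGoodReductionAt v := by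
        by_contra hbad
        exact hN _ hℓ hvS ((E.dvd_conductorNorm_iff v).mpr hbad)
      have hℓTa : (primesEquiv v : ℕ) ∉ Ta := fun hT => hvS (hTaS' hT)
      have hℓTb : (primesEquiv v : ℕ) ∉ Tb := fun hT => hvS (hTbS' hT)
      exact E.twoDescentClass_mem_selmerLocalKer_of_mk_eq_intCast h v hℓ2 hgoodv a b ma mb hma0 hmb0 hmka' hmkb'
        (hmadiv _ hℓ hℓTa (fun ℓ hℓ => hS ℓ (hTaS' hℓ))) (hmbdiv _ hℓ hℓTb (fun ℓ hℓ => hS ℓ (hTbS' hℓ)))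
  · -- the real place: both components positive
    exact twoDescentClass_mem_selmerLocalKer_of_isSquare E h _ (charZero_of_injective_algebraMap (algebraMap ℚ _).injective)
      a b (isSquare_algebraMap_completion_of_pos w hapos) (isSquare_algebraMap_completion_of_pos w hbpos)

/-- **A Selmer class of `E` with positive `T₂`-component gives a `p`-unramified Selmer class of `E^{(−p)}`.**
In the setting of the file, with `e₁ < e₂`, `e₁ < e₃`: if `c ∈ Sel⁽²⁾(E/ℚ)` has components `([a],[b])` with `0 < b`,
then `0 < a`, `c_{E^{(−p)}}(a, b) ∈ Sel⁽²⁾(E^{(−p)}/ℚ)` and `v_p(a) = v_p(b) = 0 (mod 2)`.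
[cite: SilvermanAEC2009, Prop. X.1.4, Prop. X.4.9] [cite: Kramer1981, Thm. 1] -/
theorem mem_selmerGroup_twist_of_pos (hS : ∀ q ∈ S, q.Prime) (h2S : 2 ∈ S) (h12 : e₁ < e₂) (h13 : e₁ < e₃)
    (hgood : ∀ ℓ : ℕ, (hℓ : ℓ.Prime) → ℓ ∉ S → haveI : Fact ℓ.Prime := ⟨hℓ⟩;
      padicValRat ℓ (e₁ - e₂) = 0 ∧ padicValRat ℓ (e₁ - e₃) = 0 ∧ padicValRat ℓ (e₂ - e₃) = 0)
    (hN : ∀ ℓ : ℕ, ℓ.Prime → ℓ ∉ S → ¬ ℓ ∣ E.conductorNorm ℤ)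
    (hpS : p ∉ S) (hp8 : p % 8 = 7)
    (hsplit : ∀ ℓ ∈ S, (hℓ : ℓ.Prime) → ℓ ≠ 2 → haveI : Fact ℓ.Prime := ⟨hℓ⟩; legendreSym ℓ (-(p : ℤ)) = 1)
    [(E.quadraticTwist (-(p : ℚ))).IsElliptic]
    {c : galH1Torsion E 2} (hc : c ∈ E.selmerGroup 2) (a b : ℚˣ)
    (ha : kummerEquiv ℚ 2 (E.twoTorsionCharH1 h c) = Additive.ofMul (QuotientGroup.mk a))
    (hb : kummerEquiv ℚ 2 (E.twoTorsionCharH1 h.swap₁₂ c) = Additive.ofMul (QuotientGroup.mk b)) (hbpos : 0 < (b : ℚ)) :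
    0 < (a : ℚ) ∧
      (E.quadraticTwist (-(p : ℚ))).twoDescentClass (h.quadraticTwist (-(p : ℚ))) a b ∈
        selmerGroup (E.quadraticTwist (-(p : ℚ))) 2 ∧
      parityBit p (a : ℚ) = 0 ∧ parityBit p (b : ℚ) = 0 := by
  have h' := h.quadraticTwist (-(p : ℚ))
  have hp2 : p ≠ 2 := p_ne_two hp8
  have hapos : 0 < (a : ℚ) := E.pos_of_mem_selmerGroup_of_lt h h12 h13 hc a ha
  -- square-free kernels relative to `S`
  obtain ⟨Ta, hTaS, εa, hεa, hεapos, hga, hmka, hpara, hqra⟩ := E.exists_kernel_of_mem_selmerGroup h S hS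
    (fun ℓ hℓ hℓS => ⟨(hgood ℓ hℓ hℓS).1, (hgood ℓ hℓ hℓS).2.1⟩) hc a ha
  obtain ⟨Tb, hTbS, εb, hεb, hεbpos, hgb, hmkb, hparb, hqrb⟩ := E.exists_kernel_of_mem_selmerGroup h.swap₁₂ S hS
    (fun ℓ hℓ hℓS => ⟨by rw [← neg_sub, padicValRat.neg]; exact (hgood ℓ hℓ hℓS).1, (hgood ℓ hℓ hℓS).2.2⟩) hc b hb
  have hεa1 : εa = 1 := hεapos.mpr hapos
  have hεb1 : εb = 1 := hεbpos.mpr hbpos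
  have hpTa : p ∉ Ta := fun hT => hpS (hTaS hT)
  have hpTb : p ∉ Tb := fun hT => hpS (hTbS hT)
  have hpa : parityBit p (a : ℚ) = 0 := by rw [hpara p, if_neg hpTa]
  have hpb : parityBit p (b : ℚ) = 0 := by rw [hparb p, if_neg hpTb]
  -- (R2) ⟹ `a`, `b` are residues at `p`
  have hR2 : ∀ ℓ ∈ S, qrBit p (ℓ : ℚ) = 0 := by
    intro ℓ hℓ
    by_cases hℓ2 : ℓ = 2
    · rw [hℓ2]; exact_mod_cast qrBit_two_eq_zero hp8
    · exact qrBit_prime_eq_zero_of_legendreSym hp8 (hS ℓ hℓ) hℓ2 (fun h => hpS (h ▸ hℓ)) (hsplit ℓ hℓ (hS ℓ hℓ) hℓ2)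
  have hqa : qrBit p (a : ℚ) = 0 := by
    rw [hqra p hpTa, hεa1, Finset.sum_eq_zero (fun ℓ hℓ => hR2 ℓ (hTaS hℓ)), add_zero,
      show (1 : ℚ) = 1 * 1 by norm_num, qrBit_mul_self]
  have hqb : qrBit p (b : ℚ) = 0 := by
    rw [hqrb p hpTb, hεb1, Finset.sum_eq_zero (fun ℓ hℓ => hR2 ℓ (hTbS hℓ)), add_zero,
      show (1 : ℚ) = 1 * 1 by norm_num, qrBit_mul_self]
  refine ⟨hapos, ?_, hpa, hpb⟩
  -- integer kernels
  obtain ⟨ma, hma, hmadiv⟩ := kernel_intCast (T := Ta) hεa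
  obtain ⟨mb, hmb, hmbdiv⟩ := kernel_intCast (T := Tb) hεb
  have hma0 : (ma : ℚ) ≠ 0 := by rw [hma]; exact hga
  have hmb0 : (mb : ℚ) ≠ 0 := by rw [hmb]; exact hgb
  have hmka' : (QuotientGroup.mk a : SqUnits ℚ) = QuotientGroup.mk (Units.mk0 (ma : ℚ) hma0) := by
    rw [hmka]; congr 1; exact Units.ext (by rw [Units.val_mk0, Units.val_mk0, hma])
  have hmkb' : (QuotientGroup.mk b : SqUnits ℚ) = QuotientGroup.mk (Units.mk0 (mb : ℚ) hmb0) := by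
    rw [hmkb]; congr 1; exact Units.ext (by rw [Units.val_mk0, Units.val_mk0, hmb])
  have hceq : c = E.twoDescentClass h a b := E.eq_twoDescentClass_of_kummerEquiv_eq h a b ha hb
  rw [mem_selmerGroup_iff]
  refine ⟨fun v => ?_, fun w => ?_⟩
  · by_cases hvS : (primesEquiv v : ℕ) ∈ S
    · -- `ℓ ∈ S`: transfer from `E`
      have hsq : IsSquare (algebraMap ℚ (v.adicCompletion ℚ) (-(p : ℚ))) := by
        by_cases hv2 : (primesEquiv v : ℕ) = 2
        · exact isSquare_neg_prime_adicCompletion_two hp8 v hv2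
        · haveI : Fact (primesEquiv v : ℕ).Prime := ⟨(primesEquiv v).2⟩
          exact isSquare_neg_prime_adicCompletion_odd v rfl hv2 (fun h => hpS (h ▸ hvS))
            (hsplit _ hvS (primesEquiv v).2 hv2)
      have hloc : E.twoDescentClass h a b ∈ selmerLocalKer E (v.adicCompletion ℚ) 2 := by
        rw [← hceq]; exact ((mem_selmerGroup_iff _ _ _).mp hc).1 v
      exact (E.twoDescentClass_quadraticTwist_mem_selmerLocalKer_iff (v.adicCompletion ℚ)
        (charZero_of_injective_algebraMap (algebraMap ℚ _).injective) h hsq a b).mpr hloc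
    · by_cases hvp : (primesEquiv v : ℕ) = p
      · -- at `p`: both components are `p`-adic squares
        have hsqa : IsSquare (algebraMap ℚ (v.adicCompletion ℚ) (a : ℚ)) :=
          isSquare_algebraMap_adicCompletion_of_bits v hvp hp2 a.ne_zero hpa hqa
        have hsqb : IsSquare (algebraMap ℚ (v.adicCompletion ℚ) (b : ℚ)) :=
          isSquare_algebraMap_adicCompletion_of_bits v hvp hp2 b.ne_zero hpb hqb
        exact twoDescentClass_mem_selmerLocalKer_of_isSquare (E.quadraticTwist (-(p : ℚ))) h' _
          (charZero_of_injective_algebraMap (algebraMap ℚ _).injective) a b hsqa hsqb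
      · -- `ℓ ∉ S ∪ {p}`: the twist has good reduction; unit components
        have hℓ := (primesEquiv v).2
        have hℓ2 : (primesEquiv v : ℕ) ≠ 2 := fun h2 => hvS (h2 ▸ h2S)
        have hgoodv : (E.quadraticTwist (-(p : ℚ))).HasGoodReductionAt v := by
          by_contra hbad
          have hdvd := ((E.quadraticTwist (-(p : ℚ))).dvd_conductorNorm_iff v).mpr hbad
          have hnot := not_dvd_conductorNorm_quadraticTwist_of_not_dvd E hℓ hℓ2 (hN _ hℓ hvS) (d := -(p : ℤ))
            (neg_ne_zero.mpr (by exact_mod_cast hp.out.ne_zero))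
            (fun hd => hvp ((Nat.prime_dvd_prime_iff_eq hℓ hp.out).mp (by exact_mod_cast (Int.dvd_neg.mp hd))))
          rw [show ((-(p : ℤ) : ℤ) : ℚ) = -(p : ℚ) by push_cast; rfl] at hnot
          exact hnot hdvd
        have hℓTa : (primesEquiv v : ℕ) ∉ Ta := fun hT => hvS (hTaS hT)
        have hℓTb : (primesEquiv v : ℕ) ∉ Tb := fun hT => hvS (hTbS hT)
        exact (E.quadraticTwist (-(p : ℚ))).twoDescentClass_mem_selmerLocalKer_of_mk_eq_intCast h' v hℓ2 hgoodv a b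
          ma mb hma0 hmb0 hmka' hmkb'
          (hmadiv _ hℓ hℓTa (fun ℓ hℓ => hS ℓ (hTaS hℓ))) (hmbdiv _ hℓ hℓTb (fun ℓ hℓ => hS ℓ (hTbS hℓ)))
  · exact twoDescentClass_mem_selmerLocalKer_of_isSquare (E.quadraticTwist (-(p : ℚ))) h' _
      (charZero_of_injective_algebraMap (algebraMap ℚ _).injective)
      a b (isSquare_algebraMap_completion_of_pos w hapos) (isSquare_algebraMap_completion_of_pos w hbpos)

end Transfer

end Summit.BirchSwinnertonDyer.BirchSwinnertonDyer.Theorems.GenusKolyvaginAtTwo.TorsionCellD0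

end
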